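import Mathlib
import Summits.AtomisticToContinuum.Crystallization.Theses.GappedShellCensus
import Summits.AtomisticToContinuum.Crystallization.Theses.HullMinimality
import Summits.AtomisticToContinuum.Crystallization.Theorems.PhononSlackCertificatesPeriodicGivenLayered
import Literature.MathematicalPhysics.StatisticalMechanics.BarlowStacking
import Literature.MathematicalPhysics.StatisticalMechanics.LocalMatchingCompactness
import Literature.Geometry.DiscreteGeometry.KissingPatterns
import Summits.AtomisticToContinuum.Crystallization.Theorems.GappedShellCensusCleanLimitsHaveWindowsCleanTranslate
import Summits.AtomisticToContinuum.Crystallization.Theorems.GappedShellCensusCleanLimitsHaveWindowsGappedLimitClosed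
import Summits.AtomisticToContinuum.Crystallization.Theorems.GappedShellCensusCleanLimitsHaveWindowsShellLimitClosed
import Summits.AtomisticToContinuum.Crystallization.Theorems.GappedShellCensusCleanLimitsHaveWindowsDefs
import Summits.AtomisticToContinuum.Crystallization.Theorems.GappedShellCensusCleanLimitsHaveWindowsMinimalRecurrent
import Summits.AtomisticToContinuum.Crystallization.Theorems.GappedShellCensusCleanLimitsHaveWindowsGridCount
import Summits.AtomisticToContinuum.Crystallization.Theorems.GappedShellCensusCleanLimitsHaveWindowsBallBoundarySum
import Summits.AtomisticToContinuum.Crystallization.Theorems.GappedShellCensusCleanLimitsHaveWindowsRelDense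
import Summits.AtomisticToContinuum.Crystallization.Theorems.GappedShellCensusCleanLimitsHaveWindowsDefectLipschitz
import Summits.AtomisticToContinuum.Crystallization.Theorems.GappedShellCensusCleanLimitsHaveWindowsExactShell
import Summits.AtomisticToContinuum.Crystallization.Theorems.GappedShellCensusCleanLimitsHaveWindowsClosing
import Summits.AtomisticToContinuum.Crystallization.Theorems.GappedShellCensusCleanLimitsHaveWindowsLayered
import Summits.AtomisticToContinuum.Crystallization.Theorems.GappedShellCensusCleanLimitsHaveWindowsZeroStress

/-!
# `GappedShellCensus.CleanLimitsHaveWindows` (stmt-AtomisticToContinuum-15932), line `Sketch`: the REDUCTION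
# of the crux to transversal coercivity (T2)

`cleanLimitsHaveWindows_of_coercivity`: the crux `CleanLimitsHaveWindows` follows from the single coercivity
statement T2 (= the registered stub `stub_coercivity` of the line, taken here as the hypothesis `hcoer`): there are
`κ > 0`, `C` such that for every set `Z` everywhere clean at a scale `a ∈ [47/50, 1]` and every ball `B(c, L)`, `L ≥ 1`,
`2 E_LJ(#W) − C L² + κ Σ_{p ∈ W} localDefect a Z p ≤ Σ_{p ∈ W} siteEnergy Z p`, `W = Z ∩ B(c, L)`.
Everything else of the line is LANDED and composed here: the soft half (a rooted, uniformly recurrent, everywhere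
clean hull element: `…CleanTranslate`, `…GappedLimitClosed`, `…ShellLimitClosed`, `…MinimalRecurrent`), relative
denseness (`…RelDense`), the density closing (`…Closing`), zero defect ⇒ exact shells (`…ExactShell`), exact
shells ⇒ exactly layered set (`…Layered*`), box pinning (`…BoxPinning*`, `…LayerCakeBand*`, `…MeanInplaneStress`,
`…InplaneGain*` (E1: in-plane window `(191/200, 99/100)`), `…VerticalPinning*`), and the exit through the PROVED
`LayeredHull.PeriodicGivenLayered_proof` (stmt-11779). All hypotheses are spelled out (no auxiliary predicates).
[folklore]
-/

noncomputable section

namespace Summit.AtomisticToContinuum.Crystallization.Theorems.CleanHull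

open scoped BigOperators
open Filter Metric
open Literature.MathematicalPhysics.StatisticalMechanics
open Literature.Geometry.DiscreteGeometry

/-! ## The hard half, composed from the landed stubs (T2 as hypothesis) -/

/-- **Defect-free rigidity (T3a, composed):** a non-empty everywhere-clean set with identically vanishing transversal
defect is an exactly layered set. [folklore] -/
theorem defectFreeRigid (Z : Set (EuclideanSpace ℝ (Fin 3))) (a : ℝ) (ha : 0 < a) (hne : Z.Nonempty)
    (hclean : (∀ y ∈ Z, ({w ∈ Z | w ≠ y ∧ dist y w ≤ a * (1 + 1 / 50)}.ncard = 12 ∧ ∀ w ∈ Z, w ≠ y →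
        a * (1 - 1 / 50) ≤ dist y w ∧ (dist y w ≤ a * (1 + 1 / 50) ∨ a * (63 / 50) ≤ dist y w)) ∧
        (∃ T : Finset (EuclideanSpace ℝ (Fin 3)),
        (↑T : Set (EuclideanSpace ℝ (Fin 3))) = (fun w => a⁻¹ • (w - y)) ''
            {w ∈ Z | w ≠ y ∧ dist y w ≤ a * (1 + 1 / 50)} ∧
            (ShellCloseTo (1 / 5) T fccKissingPattern ∨ ShellCloseTo (1 / 5) T hcpKissingPattern)))) (hd : ∀ p ∈ Z, localDefect a Z p = 0) :
    ∃ (a' : ℝ) (A : EuclideanSpace ℝ (Fin 3) →ₗᵢ[ℝ] EuclideanSpace ℝ (Fin 3)) (s : ℤ → ℤ) (z : ℤ → ℝ)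
      (v : EuclideanSpace ℝ (Fin 3)), 0 < a' ∧ IsHaggSeq s ∧ (∀ m : ℤ, 0 < z (m + 1) - z m) ∧
      Z = (fun p => p + v) '' {p | ∃ m i j : ℤ, p = A (((i : ℝ) • triangularVec₁ a') +
        ((j : ℝ) • triangularVec₂ a') + ((haggLabel s m : ℝ) • barlowOffset a') + (z m • layerNormal 1))} :=
  stub_layeredOfExactShells Z a ha hne hclean fun p hp =>
    stub_exactShellOfDefectZero Z a ha p hp (hclean p hp).1 (hd p hp)

/-! ## Glue -/

/-- `IsSubseqLimit` (eventually along a subsequence) gives `InHull` (frequently). [folklore] -/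
theorem inHull_of_isSubseqLimit {x : (N : ℕ) → (Fin N →
    EuclideanSpace ℝ (Fin 3))} {Y : Set (EuclideanSpace ℝ (Fin 3))}
    (h : (∃ (φ : ℕ → ℕ) (t : ℕ → EuclideanSpace ℝ (Fin 3)), StrictMono φ ∧ ∀ R ε : ℝ, 0 < ε → ∀ᶠ n in Filter.atTop,
        (∀ y ∈ Y, ‖y‖ ≤ R → ∃ i : Fin (φ n), dist (x (φ n) i + t n) y ≤ ε) ∧
        (∀ i : Fin (φ n), ‖x (φ n) i + t n‖ ≤ R → ∃ y ∈ Y, dist (x (φ n) i + t n) y ≤ ε))) : (∀ R ε : ℝ, 0 < ε →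
        ∃ᶠ N in Filter.atTop, ∃ t : EuclideanSpace ℝ (Fin 3), (∀ p ∈ Y, ‖p‖ ≤ R →
        ∃ i : Fin N, dist (x N i + t) p ≤ ε) ∧ (∀ i : Fin N, ‖x N i + t‖ ≤ R → ∃ p ∈ Y, dist (x N i + t) p ≤ ε)) := by
  obtain ⟨φ, t, hφ, hY⟩ := h
  intro R ε hε
  have hev : ∀ᶠ n in atTop, ∃ t' : EuclideanSpace ℝ (Fin 3),
      (∀ y ∈ Y, ‖y‖ ≤ R → ∃ i : Fin (φ n), dist (x (φ n) i + t') y ≤ ε) ∧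
      (∀ i : Fin (φ n), ‖x (φ n) i + t'‖ ≤ R → ∃ y ∈ Y, dist (x (φ n) i + t') y ≤ ε) :=
    (hY R ε hε).mono fun n hn => ⟨t n, hn⟩
  exact hφ.tendsto_atTop.frequently hev.frequently

/-- Clean sets are `a(1 - 1/50)`-separated. [folklore] -/
theorem sep_of_isClean {a : ℝ} {Y : Set (EuclideanSpace ℝ (Fin 3))} (hY : (∀ y ∈ Y,
    ({w ∈ Y | w ≠ y ∧ dist y w ≤ a * (1 + 1 / 50)}.ncard = 12 ∧ ∀ w ∈ Y, w ≠ y → a * (1 - 1 / 50) ≤ dist y w ∧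
    (dist y w ≤ a * (1 + 1 / 50) ∨ a * (63 / 50) ≤ dist y w)) ∧ (∃ T : Finset (EuclideanSpace ℝ (Fin 3)),
    (↑T : Set (EuclideanSpace ℝ (Fin 3))) = (fun w => a⁻¹ • (w - y)) ''
        {w ∈ Y | w ≠ y ∧ dist y w ≤ a * (1 + 1 / 50)} ∧
        (ShellCloseTo (1 / 5) T fccKissingPattern ∨ ShellCloseTo (1 / 5) T hcpKissingPattern)))) :
    ∀ p ∈ Y, ∀ q ∈ Y, p ≠ q → a * (1 - 1 / 50) ≤ dist p q :=
  fun p hp q hq hpq => ((hY p hp).1.2 q hq (Ne.symm hpq)).1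

/-- Re-rooting keeps a set in the hull (`LayeredHull.rec_hull_translate`). [folklore] -/
theorem inHull_reroot {x : (N : ℕ) → (Fin N →
    EuclideanSpace ℝ (Fin 3))} {Z : Set (EuclideanSpace ℝ (Fin 3))} (hH : (∀ R ε : ℝ, 0 < ε →
    ∃ᶠ N in Filter.atTop, ∃ t : EuclideanSpace ℝ (Fin 3), (∀ p ∈ Z, ‖p‖ ≤ R → ∃ i : Fin N, dist (x N i + t) p ≤ ε) ∧
    (∀ i : Fin N, ‖x N i + t‖ ≤ R → ∃ p ∈ Z, dist (x N i + t) p ≤ ε))) (z : EuclideanSpace ℝ (Fin 3)) :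
    (∀ R ε : ℝ, 0 < ε → ∃ᶠ N in Filter.atTop, ∃ t : EuclideanSpace ℝ (Fin 3),
        (∀ p ∈ ((fun p => p - z) '' Z), ‖p‖ ≤ R → ∃ i : Fin N, dist (x N i + t) p ≤ ε) ∧
        (∀ i : Fin N, ‖x N i + t‖ ≤ R → ∃ p ∈ ((fun p => p - z) '' Z), dist (x N i + t) p ≤ ε)) := by
  refine LayeredHull.rec_hull_translate x z hH ?_ ?_
  · rintro _ ⟨p, hp, rfl⟩
    simpa using hp
  · intro q hq
    exact ⟨q, hq, rfl⟩

/-- Local limits of hull members are hull members (`LayeredHull.rec_hull_of_forall_approx`). [folklore] -/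
theorem inHull_of_limit {x : (N : ℕ) → (Fin N → EuclideanSpace ℝ (Fin 3))} {Zs : ℕ →
    Set (EuclideanSpace ℝ (Fin 3))} {Z : Set (EuclideanSpace ℝ (Fin 3))}
    (hZs : ∀ k, (∀ R ε : ℝ, 0 < ε → ∃ᶠ N in Filter.atTop, ∃ t : EuclideanSpace ℝ (Fin 3), (∀ p ∈ (Zs k), ‖p‖ ≤ R →
        ∃ i : Fin N, dist (x N i + t) p ≤ ε) ∧ (∀ i : Fin N, ‖x N i + t‖ ≤ R → ∃ p ∈ (Zs k), dist (x N i + t) p ≤ ε)))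
    (hlim : ∀ R ε : ℝ, 0 < ε → ∀ᶠ k in atTop, BallMatch ε R 0 (Zs k) Z) : (∀ R ε : ℝ, 0 < ε →
        ∃ᶠ N in Filter.atTop, ∃ t : EuclideanSpace ℝ (Fin 3), (∀ p ∈ Z, ‖p‖ ≤ R →
        ∃ i : Fin N, dist (x N i + t) p ≤ ε) ∧ (∀ i : Fin N, ‖x N i + t‖ ≤ R → ∃ p ∈ Z, dist (x N i + t) p ≤ ε)) := by
  refine LayeredHull.rec_hull_of_forall_approx x fun R δ hδ => ?_
  obtain ⟨k, hk⟩ := (hlim R δ hδ).exists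
  refine ⟨Zs k, hZs k, fun p hp hpR => ?_, fun q hq hqR => ?_⟩
  · obtain ⟨q, hq, hqp⟩ := hk.1 p hp (by simpa using hpR)
    exact ⟨q, hq, by rwa [dist_comm]⟩
  · obtain ⟨p, hp, hqp⟩ := hk.2 q hq (by simpa using hqR)
    exact ⟨p, hp, hqp⟩

/-- **The soft half, composed: a rooted, uniformly recurrent clean hull element.** [folklore] -/
theorem cleanHullRecurrent (x : (N : ℕ) → (Fin N →
    EuclideanSpace ℝ (Fin 3))) {Y : Set (EuclideanSpace ℝ (Fin 3))} {a : ℝ} (ha : 0 < a)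
    (h0 : (0 : EuclideanSpace ℝ (Fin 3)) ∈ Y) (hH : (∀ R ε : ℝ, 0 < ε → ∃ᶠ N in Filter.atTop,
        ∃ t : EuclideanSpace ℝ (Fin 3), (∀ p ∈ Y, ‖p‖ ≤ R → ∃ i : Fin N, dist (x N i + t) p ≤ ε) ∧
        (∀ i : Fin N, ‖x N i + t‖ ≤ R → ∃ p ∈ Y, dist (x N i + t) p ≤ ε))) (hY : (∀ y ∈ Y,
        ({w ∈ Y | w ≠ y ∧ dist y w ≤ a * (1 + 1 / 50)}.ncard = 12 ∧ ∀ w ∈ Y, w ≠ y → a * (1 - 1 / 50) ≤ dist y w ∧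
        (dist y w ≤ a * (1 + 1 / 50) ∨ a * (63 / 50) ≤ dist y w)) ∧ (∃ T : Finset (EuclideanSpace ℝ (Fin 3)),
        (↑T : Set (EuclideanSpace ℝ (Fin 3))) = (fun w => a⁻¹ • (w - y)) ''
            {w ∈ Y | w ≠ y ∧ dist y w ≤ a * (1 + 1 / 50)} ∧
            (ShellCloseTo (1 / 5) T fccKissingPattern ∨ ShellCloseTo (1 / 5) T hcpKissingPattern)))) :
    ∃ Z : Set (EuclideanSpace ℝ (Fin 3)), (0 : EuclideanSpace ℝ (Fin 3)) ∈ Z ∧ (∀ R ε : ℝ, 0 < ε →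
        ∃ᶠ N in Filter.atTop, ∃ t : EuclideanSpace ℝ (Fin 3), (∀ p ∈ Z, ‖p‖ ≤ R →
        ∃ i : Fin N, dist (x N i + t) p ≤ ε) ∧ (∀ i : Fin N, ‖x N i + t‖ ≤ R → ∃ p ∈ Z, dist (x N i + t) p ≤ ε)) ∧
        (∀ y ∈ Z, ({w ∈ Z | w ≠ y ∧ dist y w ≤ a * (1 + 1 / 50)}.ncard = 12 ∧ ∀ w ∈ Z, w ≠ y →
        a * (1 - 1 / 50) ≤ dist y w ∧ (dist y w ≤ a * (1 + 1 / 50) ∨ a * (63 / 50) ≤ dist y w)) ∧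
        (∃ T : Finset (EuclideanSpace ℝ (Fin 3)),
        (↑T : Set (EuclideanSpace ℝ (Fin 3))) = (fun w => a⁻¹ • (w - y)) ''
            {w ∈ Z | w ≠ y ∧ dist y w ≤ a * (1 + 1 / 50)} ∧
            (ShellCloseTo (1 / 5) T fccKissingPattern ∨ ShellCloseTo (1 / 5) T hcpKissingPattern))) ∧
            (∀ R ε : ℝ, 0 < ε → ∃ G : ℝ, ∀ w ∈ Z, ∃ g ∈ Z, dist g w ≤ G ∧ BallMatch ε R 0 ((fun p => p - g) ''
            Z) Z) := by
  let 𝒞 : Set (Set (EuclideanSpace ℝ (Fin 3))) := {Z | (0 : EuclideanSpace ℝ (Fin 3)) ∈ Z ∧ (∀ R ε : ℝ, 0 < ε →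
      ∃ᶠ N in Filter.atTop, ∃ t : EuclideanSpace ℝ (Fin 3), (∀ p ∈ Z, ‖p‖ ≤ R →
      ∃ i : Fin N, dist (x N i + t) p ≤ ε) ∧ (∀ i : Fin N, ‖x N i + t‖ ≤ R → ∃ p ∈ Z, dist (x N i + t) p ≤ ε)) ∧
      (∀ y ∈ Z, ({w ∈ Z | w ≠ y ∧ dist y w ≤ a * (1 + 1 / 50)}.ncard = 12 ∧ ∀ w ∈ Z, w ≠ y →
      a * (1 - 1 / 50) ≤ dist y w ∧ (dist y w ≤ a * (1 + 1 / 50) ∨ a * (63 / 50) ≤ dist y w)) ∧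
      (∃ T : Finset (EuclideanSpace ℝ (Fin 3)),
      (↑T : Set (EuclideanSpace ℝ (Fin 3))) = (fun w => a⁻¹ • (w - y)) ''
          {w ∈ Z | w ≠ y ∧ dist y w ≤ a * (1 + 1 / 50)} ∧
          (ShellCloseTo (1 / 5) T fccKissingPattern ∨ ShellCloseTo (1 / 5) T hcpKissingPattern)))}
  have hδ : 0 < a * (1 - 1 / 50) := by positivity
  have hne : 𝒞.Nonempty := ⟨Y, h0, hH, hY⟩
  have hsep : ∀ Z ∈ 𝒞, ∀ p ∈ Z, ∀ q ∈ Z, p ≠ q → a * (1 - 1 / 50) ≤ dist p q :=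
    fun Z hZ => sep_of_isClean hZ.2.2
  have h0' : ∀ Z ∈ 𝒞, (0 : EuclideanSpace ℝ (Fin 3)) ∈ Z := fun Z hZ => hZ.1
  have hroot : ∀ Z ∈ 𝒞, ∀ z ∈ Z, (fun p => p - z) '' Z ∈ 𝒞 := fun Z hZ z hz =>
    ⟨⟨z, hz, sub_self z⟩, inHull_reroot hZ.2.1 z, stub_cleanTranslate a Z z hZ.2.2⟩
  have hclosed : ∀ Zs : ℕ → Set (EuclideanSpace ℝ (Fin 3)), (∀ k, Zs k ∈ 𝒞) → ∀ Z : Set (EuclideanSpace ℝ (Fin 3)),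
      (0 : EuclideanSpace ℝ (Fin 3)) ∈ Z →
      (∀ p ∈ Z, ∀ q ∈ Z, p ≠ q → a * (1 - 1 / 50) ≤ dist p q) →
      (∀ R ε : ℝ, 0 < ε → ∀ᶠ k in atTop, BallMatch ε R 0 (Zs k) Z) → Z ∈ 𝒞 := by
    intro Zs hZs Z hZ0 hZsep hlim
    have hg := stub_gappedLimitClosed a ha Zs Z (fun k y hy => ((hZs k).2.2 y hy).1) (fun k => (hZs k).1)
      hZsep hlim
    exact ⟨hZ0, inHull_of_limit (fun k => (hZs k).2.1) hlim, fun y hy => ⟨hg.2 y hy,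
      stub_shellLimitClosed a ha Zs Z (fun k => (hZs k).2.2) hg.2 hZsep hlim y hy⟩⟩
  obtain ⟨Z, hZ𝒞, hrec⟩ := stub_minimalRecurrent (a * (1 - 1 / 50)) hδ 𝒞 hne hsep h0' hroot hclosed
  exact ⟨Z, hZ𝒞.1, hZ𝒞.2.1, hZ𝒞.2.2, hrec⟩

/-- **Zero defect from coercivity (T2 ⇒ T3 at one hull element).** Under the transversal coercivity T2, a rooted,
everywhere-clean, rooted-uniformly recurrent hull element of a ground-state sequence has identically vanishing transversal
defect — relative denseness (`stub_relDense`) and the density closing (`stub_closing`, which uses T2 only AT this set).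
[folklore] -/
theorem zeroDefect_of_coercivity
    (hcoer : ∃ κ C : ℝ, 0 < κ ∧ ∀ (Z : Set (EuclideanSpace ℝ (Fin 3))) (a : ℝ), 47 / 50 ≤ a → a ≤ 1 →
      (∀ y ∈ Z, ({w ∈ Z | w ≠ y ∧ dist y w ≤ a * (1 + 1 / 50)}.ncard = 12 ∧
          ∀ w ∈ Z, w ≠ y → a * (1 - 1 / 50) ≤ dist y w ∧
            (dist y w ≤ a * (1 + 1 / 50) ∨ a * (63 / 50) ≤ dist y w)) ∧
        ∃ T : Finset (EuclideanSpace ℝ (Fin 3)), (↑T : Set (EuclideanSpace ℝ (Fin 3))) =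
            (fun w => a⁻¹ • (w - y)) '' {w ∈ Z | w ≠ y ∧ dist y w ≤ a * (1 + 1 / 50)} ∧
          (ShellCloseTo (1 / 5) T fccKissingPattern ∨ ShellCloseTo (1 / 5) T hcpKissingPattern)) →
      ∀ (c : EuclideanSpace ℝ (Fin 3)) (L : ℝ), 1 ≤ L → ∀ W : Finset (EuclideanSpace ℝ (Fin 3)),
        (↑W : Set (EuclideanSpace ℝ (Fin 3))) = Z ∩ Metric.closedBall c L →
        2 * groundStateEnergy lennardJones 3 W.card - C * L ^ 2 + κ * ∑ p ∈ W, localDefect a Z p ≤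
          ∑ p ∈ W, siteEnergy Z p)
    (x : (N : ℕ) → (Fin N → EuclideanSpace ℝ (Fin 3)))
    (hx : ∀ N, IsGroundState lennardJones (x N)) (Z : Set (EuclideanSpace ℝ (Fin 3))) (a : ℝ)
    (ha : 47 / 50 ≤ a) (ha1 : a ≤ 1) (h0 : (0 : EuclideanSpace ℝ (Fin 3)) ∈ Z)
    (hH : ∀ R ε : ℝ, 0 < ε → ∃ᶠ N in Filter.atTop, ∃ t : EuclideanSpace ℝ (Fin 3), (∀ p ∈ Z, ‖p‖ ≤ R →
        ∃ i : Fin N, dist (x N i + t) p ≤ ε) ∧ (∀ i : Fin N, ‖x N i + t‖ ≤ R → ∃ p ∈ Z, dist (x N i + t) p ≤ ε))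
    (hclean : ∀ y ∈ Z, ({w ∈ Z | w ≠ y ∧ dist y w ≤ a * (1 + 1 / 50)}.ncard = 12 ∧ ∀ w ∈ Z, w ≠ y →
        a * (1 - 1 / 50) ≤ dist y w ∧ (dist y w ≤ a * (1 + 1 / 50) ∨ a * (63 / 50) ≤ dist y w)) ∧
        (∃ T : Finset (EuclideanSpace ℝ (Fin 3)),
        (↑T : Set (EuclideanSpace ℝ (Fin 3))) = (fun w => a⁻¹ • (w - y)) ''
            {w ∈ Z | w ≠ y ∧ dist y w ≤ a * (1 + 1 / 50)} ∧
            (ShellCloseTo (1 / 5) T fccKissingPattern ∨ ShellCloseTo (1 / 5) T hcpKissingPattern)))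
    (hrec : ∀ R ε : ℝ, 0 < ε → ∃ G : ℝ, ∀ w ∈ Z, ∃ g ∈ Z, dist g w ≤ G ∧ BallMatch ε R 0 ((fun p => p - g) '' Z) Z) :
    ∀ p ∈ Z, localDefect a Z p = 0 := by
  have ha0 : 0 < a := by linarith
  exact stub_closing x hx Z a ha ha1 hH hclean hrec (stub_relDense a ha0 Z ⟨0, h0⟩ hclean) hcoer

/-! ## Composition: the crux from the stubs -/

/-- **The crux from T3 (exactness of recurrent clean hull elements).** If every rooted, everywhere-clean,
rooted-uniformly recurrent hull element of a Lennard-Jones ground-state sequence (scale `a ∈ [47/50, 1]`) has identically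
vanishing transversal defect, then `GappedShellCensus.CleanLimitsHaveWindows` holds: soft half (such a hull element exists
in the clean rooted hull of the clean local limit), defect-free rigidity (it is an exactly layered set), box pinning (a
layered hull element in the box of stmt-11779), and the PROVED `LayeredHull.PeriodicGivenLayered_proof`. T3 is the exact
remaining content of the line (weaker than T2, see `cleanLimitsHaveWindows_of_coercivity`). [folklore] -/
theorem cleanLimitsHaveWindows_of_exactHull
    (hT3 : ∀ x : (N : ℕ) → (Fin N → EuclideanSpace ℝ (Fin 3)), (∀ N, IsGroundState lennardJones (x N)) →
      ∀ (Z : Set (EuclideanSpace ℝ (Fin 3))) (a : ℝ), 47 / 50 ≤ a → a ≤ 1 → (0 : EuclideanSpace ℝ (Fin 3)) ∈ Z →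
      (∀ R ε : ℝ, 0 < ε → ∃ᶠ N in Filter.atTop, ∃ t : EuclideanSpace ℝ (Fin 3), (∀ p ∈ Z, ‖p‖ ≤ R →
          ∃ i : Fin N, dist (x N i + t) p ≤ ε) ∧ (∀ i : Fin N, ‖x N i + t‖ ≤ R → ∃ p ∈ Z, dist (x N i + t) p ≤ ε)) →
      (∀ y ∈ Z, ({w ∈ Z | w ≠ y ∧ dist y w ≤ a * (1 + 1 / 50)}.ncard = 12 ∧ ∀ w ∈ Z, w ≠ y →
          a * (1 - 1 / 50) ≤ dist y w ∧ (dist y w ≤ a * (1 + 1 / 50) ∨ a * (63 / 50) ≤ dist y w)) ∧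
          (∃ T : Finset (EuclideanSpace ℝ (Fin 3)),
          (↑T : Set (EuclideanSpace ℝ (Fin 3))) = (fun w => a⁻¹ • (w - y)) ''
              {w ∈ Z | w ≠ y ∧ dist y w ≤ a * (1 + 1 / 50)} ∧
              (ShellCloseTo (1 / 5) T fccKissingPattern ∨ ShellCloseTo (1 / 5) T hcpKissingPattern))) →
      (∀ R ε : ℝ, 0 < ε → ∃ G : ℝ, ∀ w ∈ Z, ∃ g ∈ Z, dist g w ≤ G ∧ BallMatch ε R 0 ((fun p => p - g) '' Z) Z) →
      ∀ p ∈ Z, localDefect a Z p = 0) :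
    Summit.AtomisticToContinuum.Crystallization.Theses.GappedShellCensus.CleanLimitsHaveWindows := by
  intro x hx Y a ha ha1 h0 hlim hclean
  have ha0 : 0 < a := by linarith
  -- soft half: a rooted, uniformly recurrent, clean hull element
  obtain ⟨Z, hZ0, hZH, hZc, hZr⟩ :=
    cleanHullRecurrent x ha0 h0 (inHull_of_isSubseqLimit hlim) hclean
  -- exactification: zero defect (T3), hence an exactly layered set
  obtain ⟨a', A, s, z, v, ha', hs, hz, hZeq⟩ :=
    defectFreeRigid Z a ha0 ⟨0, hZ0⟩ hZc (hT3 x hx Z a ha ha1 hZ0 hZH hZc hZr)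
  -- box pinning: a layered hull element with parameters in the box of stmt-11779
  obtain ⟨a'', A', s', z', h1, h2, hs', hz', hH'⟩ :=
    boxPinning x hx a a' ha ha1 ha' A s z v hs hz Z hZeq hZc hZH (hZeq ▸ hZr)
  -- exit through the proved crux `PeriodicGivenLayered`
  exact LayeredHull.PeriodicGivenLayered_proof x hx ⟨a'', h1, h2, fun R ε hε =>
    (hH' R ε hε).mono fun N hN => by
      obtain ⟨t, ht⟩ := hN
      exact ⟨A', t, s', z', hs', hz', ht⟩⟩

/-- **The crux from T2 (transversal coercivity) — the REDUCTION.** `GappedShellCensus.CleanLimitsHaveWindows`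
(stmt-AtomisticToContinuum-15932) follows from the coercivity statement T2 alone (= the registered `stub_coercivity` of line
`Sketch`): T2 ⇒ T3 (`zeroDefect_of_coercivity`) ⇒ crux (`cleanLimitsHaveWindows_of_exactHull`). [folklore] -/
theorem cleanLimitsHaveWindows_of_coercivity
    (hcoer : ∃ κ C : ℝ, 0 < κ ∧ ∀ (Z : Set (EuclideanSpace ℝ (Fin 3))) (a : ℝ), 47 / 50 ≤ a → a ≤ 1 →
      (∀ y ∈ Z, ({w ∈ Z | w ≠ y ∧ dist y w ≤ a * (1 + 1 / 50)}.ncard = 12 ∧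
          ∀ w ∈ Z, w ≠ y → a * (1 - 1 / 50) ≤ dist y w ∧
            (dist y w ≤ a * (1 + 1 / 50) ∨ a * (63 / 50) ≤ dist y w)) ∧
        ∃ T : Finset (EuclideanSpace ℝ (Fin 3)), (↑T : Set (EuclideanSpace ℝ (Fin 3))) =
            (fun w => a⁻¹ • (w - y)) '' {w ∈ Z | w ≠ y ∧ dist y w ≤ a * (1 + 1 / 50)} ∧
          (ShellCloseTo (1 / 5) T fccKissingPattern ∨ ShellCloseTo (1 / 5) T hcpKissingPattern)) →
      ∀ (c : EuclideanSpace ℝ (Fin 3)) (L : ℝ), 1 ≤ L → ∀ W : Finset (EuclideanSpace ℝ (Fin 3)),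
        (↑W : Set (EuclideanSpace ℝ (Fin 3))) = Z ∩ Metric.closedBall c L →
        2 * groundStateEnergy lennardJones 3 W.card - C * L ^ 2 + κ * ∑ p ∈ W, localDefect a Z p ≤
          ∑ p ∈ W, siteEnergy Z p) :
    Summit.AtomisticToContinuum.Crystallization.Theses.GappedShellCensus.CleanLimitsHaveWindows :=
  cleanLimitsHaveWindows_of_exactHull fun x hx Z a ha ha1 h0 hH hclean hrec =>
    zeroDefect_of_coercivity hcoer x hx Z a ha ha1 h0 hH hclean hrec

end Summit.AtomisticToContinuum.Crystallization.Theorems.CleanHull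

end
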